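import Mathlib
import HarnessLib

/-!
# Weil-type family coverage — LEMMA Ψ and THEOREM Λ (the Lagrangian bidegree bound for product-action windows) (ring2-b02, gen 69)

research route conditional on HC_CM; not a corollary; Q11.4-sentence-2 already refuted in dim ≥ 3.

Ring 2, WEIL-TYPE FAMILY-COVERAGE CENSUS (`HOME/WEIL-FAMILY-COVERAGE.md` `## b02 (g = 6)`, block b02.29, owner ring2-b02).
Block b02.28 (THEOREMS Z / P / P′ / P″) closed the product-action window `G₂ ≤ S_a × S_b`, `V = St_a ⊠ St_b`, of the carriers
`GL₂(3)`, `SD₁₆`, `PSL₂(7)`, `F₂₁`, `PSL₂(11)` on the ten residual sixfold rows by per-slot fixed-count caps plus exact censuses of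
the small sides, and left the reflection carrier `G₂₄` open: its reflection slots escape every per-slot cap.  Block b02.29 replaces
the per-slot route by ONE identity and ONE inequality that couple all slots through Riemann–Hurwitz on both sides:

* **LEMMA Ψ (orbit count).**  For `y = (σ, τ)` the `⟨y⟩`-orbits on `C × C′` (`C` a cycle of `σ` of length `ℓ`, `C′` of `τ` of length
  `ℓ′`) are `gcd(ℓ,ℓ′)` cycles of length `lcm(ℓ,ℓ′)`; hence `Fix_j(V) = Σ_{C,C′} gcd(ℓ,ℓ′)·w_j(lcm(ℓ,ℓ′)) − Fix_j(St_a) − Fix_j(St_b) − φ_j`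
  with `w_j(L) = #{x ∈ X_j : Lx ∈ ℤ}`, and (Chevalley–Weil) the MASTER IDENTITY
  `𝔊 := Σ_j Σ_{C,C′} ℓℓ′·[ψ_j(lcm) − ψ_j(ℓ)/b − ψ_j(ℓ′)/a] = (N−2)f(v−1) − 6 + r₁`, `ψ_j(L) = w_j(L)/L`, `r₁ ≥ 0`.
  The arithmetic fact used per pair of cycles is `gcd·lcm = ℓℓ′` (`orbit_count_mul_length`).
* **THEOREM Λ (weak duality).**  With multipliers `λ, μ ≥ 0` for the two Riemann–Hurwitz constraints `Σ_j cyc σ_j ≤ (N−2)a + 2`,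
  `Σ_j cyc τ_j ≤ (N−2)b + 2` (pair weights `ℓℓ′`, penalties `1/ℓ`, `1/ℓ′`) and per-slot suprema `t_j ≥ ψ_j(lcm) − … − λ/ℓ − μ/ℓ′`:
  `𝔊 ≤ ab·Σ t_j + λ·b((N−2)a+2) + μ·a((N−2)b+2)` (`weak_duality`), so `Λ(a,b;λ,μ) < (N−2)f(1 − 1/a − 1/b) − 6/(ab)` excludes the
  bidegree `(a,b)` for the signature (`no_datum_of_dual_lt`).
* **CORNER LEMMA.**  A supremum of affine functions grows at most at its leading-slope rate (`affine_sup_le`), so a certificate at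
  `b = B` and one "at infinity" with the same multipliers cover every `b ≥ B` (`neg_of_corners`); four corners cover `a ≥ A, b ≥ B`.
* §4 records the exact asymptotic corner of the headline certificate: `G₂₄` `(−2A, −3A, 7A)` with `λ = μ = 3/8` has
  `Λ(∞,∞) = 3/4 + 5/4 + 3/8 + 9/28 < 3` (`g24_reflection_corner_lt_three`) — the signature is hyperbolic (`1/2 + 1/6 + 1/7 < 1`).

The certificates themselves (pairs `lcm ≤ 420` enumerated, tail `(f−λ−μ)⁺/421`, exact rationals) are machine output
(`weilcov/g69/prod/psi.py`, `closure_*.json`); this file checks the inequalities they are assembled from, not the enumeration.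
Nothing in this file is a statement about Hodge classes; `HC_CM` is used nowhere; no `def`, no named fact.
References: [cite: vanGeemen1994HodgeAV, 5.2 and (5.4.1)] (the Weil-type hidden factor and its hermitian form);
Chevalley–Weil multiplicity formula [cite: Serre1973, Ch. III §1] as used in b02.21 / b02.28.
-/

set_option linter.dupNamespace false

namespace Summit.HodgeConjecture.HodgeConjecture.Ring2.WeilCoverage

namespace LagrangianBound

open Finset

/-! ### §1 LEMMA Ψ — the one arithmetic fact per pair of cycles -/

/-- **LEMMA Ψ, arithmetic kernel.**  On `C × C′` (`|C| = ℓ`, `|C′| = ℓ′`) the cyclic group `⟨(σ,τ)⟩` has `gcd(ℓ,ℓ′)` orbits, each of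
length `lcm(ℓ,ℓ′)`: (number of orbits) × (orbit length) = `ℓ·ℓ′`.  Hence the pair weight `gcd(ℓ,ℓ′)·w(lcm)` equals `ℓℓ′·ψ(lcm)`.
research route conditional on HC_CM; not a corollary; Q11.4-sentence-2 already refuted in dim ≥ 3. [folklore] -/
theorem orbit_count_mul_length (l l' : ℕ) : Nat.gcd l l' * Nat.lcm l l' = l * l' :=
  Nat.gcd_mul_lcm l l'

/-- The pair weight in rational form: with `ψ·lcm(ℓ,ℓ′) = w` (i.e. `ψ = w(lcm)/lcm`), `gcd(ℓ,ℓ′)·w = ℓℓ′·ψ`.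
research route conditional on HC_CM; not a corollary; Q11.4-sentence-2 already refuted in dim ≥ 3. [folklore] -/
theorem pair_weight_eq (l l' : ℕ) (w psi : ℚ) (hpsi : psi * (Nat.lcm l l' : ℚ) = w) :
    (Nat.gcd l l' : ℚ) * w = (l : ℚ) * l' * psi := by
  have hq : (Nat.gcd l l' : ℚ) * (Nat.lcm l l' : ℚ) = (l : ℚ) * l' := by exact_mod_cast orbit_count_mul_length l l'
  rw [← hq, ← hpsi]
  ring

/-! ### §2 THEOREM Λ — weak duality for the two Riemann–Hurwitz constraints -/

/-- **THEOREM Λ (weak duality).**  Pairs `i` (one per slot `j` and pair of cycles `(C,C′)`) carry weights `w i = ℓℓ′ ≥ 0`, values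
`g i = ψ_j(lcm) − ψ_j(ℓ)/b − ψ_j(ℓ′)/a` and penalties `pa i = 1/ℓ`, `pb i = 1/ℓ′`; the Riemann–Hurwitz constraints read
`Σ w·pa ≤ A := b((N−2)a+2)`, `Σ w·pb ≤ B := a((N−2)b+2)`.  If `g i ≤ t i + λ·pa i + μ·pb i` (the per-slot suprema) with `λ, μ ≥ 0`, then
`𝔊 = Σ w·g ≤ Σ w·t + λA + μB`.
research route conditional on HC_CM; not a corollary; Q11.4-sentence-2 already refuted in dim ≥ 3. [folklore] -/
theorem weak_duality {ι : Type*} (s : Finset ι) (w g t pa pb : ι → ℚ) {lam mu A B : ℚ}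
    (hw : ∀ i ∈ s, 0 ≤ w i) (hg : ∀ i ∈ s, g i ≤ t i + lam * pa i + mu * pb i)
    (hA : ∑ i ∈ s, w i * pa i ≤ A) (hB : ∑ i ∈ s, w i * pb i ≤ B) (hlam : 0 ≤ lam) (hmu : 0 ≤ mu) :
    ∑ i ∈ s, w i * g i ≤ ∑ i ∈ s, w i * t i + lam * A + mu * B := by
  have h1 : ∑ i ∈ s, w i * g i ≤ ∑ i ∈ s, w i * (t i + lam * pa i + mu * pb i) :=
    Finset.sum_le_sum fun i hi => mul_le_mul_of_nonneg_left (hg i hi) (hw i hi)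
  have h2 : ∑ i ∈ s, w i * (t i + lam * pa i + mu * pb i)
      = ∑ i ∈ s, w i * t i + lam * ∑ i ∈ s, w i * pa i + mu * ∑ i ∈ s, w i * pb i := by
    rw [Finset.mul_sum, Finset.mul_sum, ← Finset.sum_add_distrib, ← Finset.sum_add_distrib]
    refine Finset.sum_congr rfl fun i _ => ?_
    ring
  have h3 : lam * ∑ i ∈ s, w i * pa i ≤ lam * A := mul_le_mul_of_nonneg_left hA hlam
  have h4 : mu * ∑ i ∈ s, w i * pb i ≤ mu * B := mul_le_mul_of_nonneg_left hB hmu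
  linarith

/-- **Exclusion criterion.**  The MASTER IDENTITY gives `𝔊 = c + r₁` with `c = (N−2)f(v−1) − 6` and `r₁ ≥ 0` (a Chevalley–Weil
multiplicity); a dual bound `𝔊 ≤ D` with `D < c` is a contradiction: no datum of this signature and bidegree.
research route conditional on HC_CM; not a corollary; Q11.4-sentence-2 already refuted in dim ≥ 3. [folklore] -/
theorem no_datum_of_dual_lt {G c r D : ℚ} (hG : G = c + r) (hr : 0 ≤ r) (hD : G ≤ D) (hlt : D < c) : False := by
  linarith

/-- The normalised right-hand side: `((N−2)f(v−1) − 6)/(ab) = (N−2)f(1 − 1/a − 1/b) − 6/(ab)` for `v = (a−1)(b−1)`.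
research route conditional on HC_CM; not a corollary; Q11.4-sentence-2 already refuted in dim ≥ 3. [folklore] -/
theorem rhs_normalised (n f a b : ℚ) (ha : a ≠ 0) (hb : b ≠ 0) :
    (n * f * ((a - 1) * (b - 1) - 1) - 6) / (a * b) = n * f * (1 - 1 / a - 1 / b) - 6 / (a * b) := by
  field_simp
  ring

/-- **Tail bound.**  For a pair with `lcm = L > L₀`: `ψ(L) ≤ f/L` and `ℓ, ℓ′ ≤ L` give
`ψ(L) − λ/ℓ − μ/ℓ′ ≤ (f − λ − μ)/L`, which is at most `max(0, f−λ−μ)/(L₀+1)`.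
research route conditional on HC_CM; not a corollary; Q11.4-sentence-2 already refuted in dim ≥ 3. [folklore] -/
theorem tail_bound {psi f lam mu l l' L L0 : ℚ} (hpsi : psi ≤ f / L) (hl : 0 < l) (hl' : 0 < l') (hlL : l ≤ L) (hl'L : l' ≤ L)
    (hL : L0 + 1 ≤ L) (hL0 : 0 ≤ L0) (hlam : 0 ≤ lam) (hmu : 0 ≤ mu) :
    psi - lam / l - mu / l' ≤ max 0 (f - lam - mu) / (L0 + 1) := by
  have hLpos : 0 < L := by linarith
  have h1 : lam / L ≤ lam / l := div_le_div_of_nonneg_left hlam hl hlL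
  have h2 : mu / L ≤ mu / l' := div_le_div_of_nonneg_left hmu hl' hl'L
  have h3 : psi - lam / l - mu / l' ≤ (f - lam - mu) / L := by
    have : (f - lam - mu) / L = f / L - lam / L - mu / L := by ring
    linarith
  have h4 : (f - lam - mu) / L ≤ max 0 (f - lam - mu) / (L0 + 1) := by
    rcases le_or_gt 0 (f - lam - mu) with hnn | hneg
    · calc (f - lam - mu) / L ≤ (f - lam - mu) / (L0 + 1) :=
            div_le_div_of_nonneg_left hnn (by linarith) hL
        _ ≤ max 0 (f - lam - mu) / (L0 + 1) :=
            div_le_div_of_nonneg_right (le_max_right _ _) (by linarith)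
    · have : (f - lam - mu) / L ≤ 0 := div_nonpos_of_nonpos_of_nonneg hneg.le hLpos.le
      have h0 : (0 : ℚ) ≤ max 0 (f - lam - mu) / (L0 + 1) :=
        div_nonneg (le_max_left _ _) (by linarith)
      linarith
  linarith

/-! ### §3 The corner lemma — certificates at `B` and at infinity cover every `b ≥ B` -/

/-- **Affine supremum growth.**  For a nonempty finite family of affine functions `b ↦ α k · b + β k` and `B ≤ b`:
`sup_k (α k · b + β k) ≤ sup_k (α k · B + β k) + (b − B) · sup_k α k`.
research route conditional on HC_CM; not a corollary; Q11.4-sentence-2 already refuted in dim ≥ 3. [folklore] -/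
theorem affine_sup_le {κ : Type*} (S : Finset κ) (hS : S.Nonempty) (α β : κ → ℚ) {B b : ℚ} (hb : B ≤ b) :
    S.sup' hS (fun k => α k * b + β k) ≤ S.sup' hS (fun k => α k * B + β k) + (b - B) * S.sup' hS α := by
  refine Finset.sup'_le hS _ fun k hk => ?_
  have h1 : α k * B + β k ≤ S.sup' hS (fun k => α k * B + β k) := Finset.le_sup' (fun k => α k * B + β k) hk
  have h2 : α k ≤ S.sup' hS α := Finset.le_sup' α hk
  have h3 : (b - B) * α k ≤ (b - B) * S.sup' hS α := mul_le_mul_of_nonneg_left h2 (by linarith)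
  have : α k * b + β k = (α k * B + β k) + (b - B) * α k := by ring
  linarith

/-- **Corner lemma.**  If `φ(b) ≤ φ(B) + (b − B)·s` for `b ≥ B` (the shape `affine_sup_le` gives slot by slot, summed), and both the
certificate at the corner `φ(B) < 0` and the certificate at infinity `s < 0` hold, then `φ(b) < 0` for every `b ≥ B`.
research route conditional on HC_CM; not a corollary; Q11.4-sentence-2 already refuted in dim ≥ 3. [folklore] -/
theorem neg_of_corners {φ : ℚ → ℚ} {B s : ℚ} (hgrowth : ∀ b, B ≤ b → φ b ≤ φ B + (b - B) * s)
    (hB : φ B < 0) (hs : s < 0) {b : ℚ} (hb : B ≤ b) : φ b < 0 := by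
  have h := hgrowth b hb
  have : (b - B) * s ≤ 0 := mul_nonpos_of_nonneg_of_nonpos (by linarith) hs.le
  linarith

/-! ### §4 The headline certificate's asymptotic corner (`G₂₄`, reflection signature `(−2A, −3A, 7A)`) -/

/-- The `ψ`-weights of the three classes at their maximising pairs with `λ = μ = 3/8`, corner `(∞,∞)`:
`−2A` (exponents `½,0,0`): pair `(1,1)`, `ψ(1) = 2`, `t₁ = 2 − 3/8 − 3/8 = 5/4`;
`−3A` (`½,⅙,⅚`): pair `(6,6)`, `ψ(6) = 3/6`, `t₂ = 1/2 − 1/16 − 1/16 = 3/8`;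
`7A` (`1/7,2/7,4/7`): pair `(7,7)`, `ψ(7) = 3/7`, `t₃ = 3/7 − 3/56 − 3/56 = 9/28`.
research route conditional on HC_CM; not a corollary; Q11.4-sentence-2 already refuted in dim ≥ 3. [folklore] -/
theorem g24_reflection_slot_values :
    (2 : ℚ) - 3/8 - 3/8 = 5/4 ∧ (3 : ℚ)/6 - (3/8)/6 - (3/8)/6 = 3/8 ∧ (3 : ℚ)/7 - (3/8)/7 - (3/8)/7 = 9/28 := by
  norm_num

/-- **The corner at infinity is below the budget:** `Λ(∞,∞; 3/8, 3/8) = (3/8 + 3/8)·1 + 5/4 + 3/8 + 9/28 = 151/56 < 3 = (N−2)f`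
for `N = 3`, `f = 3`.  (The finite corners `(8,8)`, `(8,∞)`, `(∞,8)` of the certificate «no `G₂₄` `(−2A,−3A,7A)` product-action datum
with `a, b ≥ 8`» are machine-checked in exact rationals by `psi.py`; this is the one that says the signature is hyperbolic.)
research route conditional on HC_CM; not a corollary; Q11.4-sentence-2 already refuted in dim ≥ 3. [folklore] -/
theorem g24_reflection_corner_lt_three : (3 : ℚ)/8 + 3/8 + (5/4 + 3/8 + 9/28) < 3 := by
  norm_num

/-- Why the reflection signature is hyperbolic: full-weight pairs (`w = f = 3`) need `2 ∣ L`, `6 ∣ L`, `7 ∣ L` in the three slots, and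
`1/2 + 1/6 + 1/7 < 1` — the homocyclic Riemann–Hurwitz budget cannot be met (cf. `1/2 + 1/3 + 1/7 < 1` for `PSL₂(7)` itself).
research route conditional on HC_CM; not a corollary; Q11.4-sentence-2 already refuted in dim ≥ 3. [folklore] -/
theorem hyperbolic_two_six_seven : (1 : ℚ)/2 + 1/6 + 1/7 < 1 ∧ (1 : ℚ)/2 + 1/3 + 1/7 < 1 := by
  norm_num

/-- With `λ = μ = 3/2` every slot supremum is `≤ 0` up to the tail (`w ≤ f = 3` gives `ψ(L) − 3/(2ℓ) − 3/(2ℓ′) ≤ 3/L − 3/L = 0` at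
`ℓ = ℓ′ = L`), so `Λ(∞,∞) ≤ 3`: the trivial multipliers reproduce exactly the budget and decide nothing — the gain is all in `λ + μ < 3`.
research route conditional on HC_CM; not a corollary; Q11.4-sentence-2 already refuted in dim ≥ 3. [folklore] -/
theorem trivial_multipliers (L : ℚ) (hL : 0 < L) (w : ℚ) (hw : w ≤ 3) : w / L - (3/2) / L - (3/2) / L ≤ 0 := by
  have : w / L - (3/2) / L - (3/2) / L = (w - 3) / L := by ring
  rw [this]
  exact div_nonpos_of_nonpos_of_nonneg (by linarith) hL.le

/-! ### §5 THEOREM Λ∞ — every faithful carrier, every signature, uniformly in `N ≥ 5` and in the base genus (gen 69, appended)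

With `χ = 2g₀ − 2 + N` in place of `N − 2` and the multipliers `λ = μ = (f−1)/2`, every slot supremum is `≤ 1/2` for a carrier that is
faithful on `W₁` (`φ(c) ≤ f − 1` for `c ≠ 1`): the three kinds of cycle pairs are `slot_pair_one_one`, `slot_pair_one_large`,
`slot_pair_large_large`.  Hence `Λ ≤ (f−1)(χ + 1/a + 1/b) + N/2`, and comparing with the budget `χf(1 − 1/a − 1/b) − 6/(ab)` gives
`lambda_infinity`: whenever `2χ > N` (base genus `≥ 1`, or genus `0` with `N ≥ 5` branch points) every product-action sixfold datum has
`(1/a + 1/b)((χ+1)f − 1) + 6/(ab) ≥ (2χ − N)/2` — the per-signature tables of block b02.29 are needed exactly for genus `0`, `N ∈ {3,4}`. -/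

/-- Pair `(ℓ,ℓ′) = (1,1)` (fixed point × fixed point): `ψ(1) = φ ≤ f − 1`, so `ψ(1) − λ − μ ≤ 0` for `λ = μ = (f−1)/2`.
research route conditional on HC_CM; not a corollary; Q11.4-sentence-2 already refuted in dim ≥ 3. [folklore] -/
theorem slot_pair_one_one {phi f : ℚ} (hphi : phi ≤ f - 1) : phi - (f - 1) / 2 - (f - 1) / 2 ≤ 0 := by
  linarith

/-- Pair `(1, ℓ′)` with `ℓ′ ≥ 2`: `ψ(ℓ′) ≤ f/ℓ′` gives `ψ(ℓ′) − λ − μ/ℓ′ ≤ (f+1)/(2ℓ′) − (f−1)/2 ≤ (3−f)/4 ≤ 1/2` for `f ≥ 1`.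
research route conditional on HC_CM; not a corollary; Q11.4-sentence-2 already refuted in dim ≥ 3. [folklore] -/
theorem slot_pair_one_large {psi f l : ℚ} (hf : 1 ≤ f) (hl : 2 ≤ l) (hpsi : psi ≤ f / l) :
    psi - (f - 1) / 2 - ((f - 1) / 2) / l ≤ 1 / 2 := by
  have hlpos : 0 < l := by linarith
  have h1 : psi - ((f - 1) / 2) / l ≤ (f - (f - 1) / 2) / l := by
    have : (f - (f - 1) / 2) / l = f / l - ((f - 1) / 2) / l := by ring
    linarith
  have hnum : 0 ≤ f - (f - 1) / 2 := by linarith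
  have h2 : (f - (f - 1) / 2) / l ≤ (f - (f - 1) / 2) / 2 :=
    div_le_div_of_nonneg_left hnum (by norm_num) hl
  linarith

/-- Pair `(ℓ,ℓ′)` with both lengths `≥ 2`, `M = max(ℓ,ℓ′) ≤ lcm`: `ψ ≤ f/M` and `1/ℓ + 1/ℓ′ ≥ 2/M` give
`ψ − λ(1/ℓ + 1/ℓ′) ≤ f/M − (f−1)/M = 1/M ≤ 1/2` for `λ = (f−1)/2`.
research route conditional on HC_CM; not a corollary; Q11.4-sentence-2 already refuted in dim ≥ 3. [folklore] -/
theorem slot_pair_large_large {psi f M s : ℚ} (hf : 1 ≤ f) (hM : 2 ≤ M) (hpsi : psi ≤ f / M) (hs : 2 / M ≤ s) :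
    psi - (f - 1) / 2 * s ≤ 1 / 2 := by
  have hMpos : 0 < M := by linarith
  have hlam : 0 ≤ (f - 1) / 2 := by linarith
  have h1 : (f - 1) / 2 * (2 / M) ≤ (f - 1) / 2 * s := mul_le_mul_of_nonneg_left hs hlam
  have h2 : f / M - (f - 1) / 2 * (2 / M) = 1 / M := by
    field_simp
    ring
  have h3 : 1 / M ≤ (1 : ℚ) / 2 := by
    rw [div_le_div_iff₀ hMpos (by norm_num : (0:ℚ) < 2)]
    linarith
  linarith

/-- **THEOREM Λ∞ (assembly).**  If every slot supremum is `≤ 1/2` (so `Λ ≤ (f−1)(χ + 1/a + 1/b) + N/2` with `λ = μ = (f−1)/2`) and a datum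
exists (`budget ≤ Λ`), then `(1/a + 1/b)((χ+1)f − 1) + 6/(ab) ≥ (2χ − N)/2`.  Contrapositive: the strict reverse inequality excludes the
bidegree — uniformly for every faithful carrier and signature once `2χ > N`.
research route conditional on HC_CM; not a corollary; Q11.4-sentence-2 already refuted in dim ≥ 3. [folklore] -/
theorem lambda_infinity {f chi N ia ib Lam : ℚ}
    (hLam : Lam ≤ (f - 1) * (chi + ia + ib) + N / 2)
    (hbudget : chi * f * (1 - ia - ib) - 6 * (ia * ib) ≤ Lam) :
    (2 * chi - N) / 2 ≤ (ia + ib) * ((chi + 1) * f - 1) + 6 * (ia * ib) := by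
  nlinarith

/-- The explicit bound on the smaller side: with `m = min(a,b) ≥ 1`, `1/a + 1/b ≤ 2/m` and `6/(ab) ≤ 6/m ` turn Λ∞ into
`(2χ − N)/2 ≤ (2K + 6)/m` (`K = (χ+1)f − 1`), i.e. `m ≤ (4K + 12)/(2χ − N) = (4(χ+1)f + 8)/(2χ − N)` when `2χ > N`.
research route conditional on HC_CM; not a corollary; Q11.4-sentence-2 already refuted in dim ≥ 3. [folklore] -/
theorem min_side_bound {K D m : ℚ} (hm : 0 < m) (hD : 0 < D) (h : D / 2 ≤ (2 * K + 6) / m) :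
    m ≤ (4 * K + 12) / D := by
  rw [le_div_iff₀ hD]
  rw [div_le_div_iff₀ (by norm_num : (0:ℚ) < 2) hm] at h
  linarith

end LagrangianBound

end Summit.HodgeConjecture.HodgeConjecture.Ring2.WeilCoverage
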